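import Summits.PneNP.PneNP.Theses.RootDecompAlternationDial

/-!
# `RootDecompAlternationDial.BoundedAltLiftD` (stmt-PneNP-30829) — the alternation dial's decided bottom

Node N14 of the decomp-pnenp root-decomposition cell (route `route-PneNP-RootDecompAlternationDial`,
rev 7, re-typed over the input-anchored tree class `Literature.Computability.Complexity.SigmaDepth`,
p765627) files, as a support-designate aside, the residual at every BOUNDED alternation depth:
`∀ k, NP ⊆ P → SigmaDepth (fun _ => k) ⊆ P`.  It is a theorem — the tree lemma
`sigmaDepth_subset_P_of_bounded` (NP ⊆ P collapses every Σₖᵖ, and a depth-`k` input-anchored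
alternation is a Σₖᵖ computation by the Stockmeyer bridge).  One-line port certified by the cell
critic (§CriticL6g9.boundedAltLiftT_holds, 2026-08-30T07:48:24Z).  0 sorry.
-/

namespace Summit.PneNP.PneNP.Theorems

/-- `BoundedAltLiftD` (stmt-PneNP-30829): at every constant alternation depth `k` the lift
`NP ⊆ P → SigmaDepth (fun _ => k) ⊆ P` holds, by the tree lemma
`Literature.Computability.Complexity.sigmaDepth_subset_P_of_bounded` with the constant bound
`s n = k ≤ k` (decomp-pnenp cell, N14 decided bottom, 2026-08-30). -/
theorem boundedAltLiftD_proof :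
    Summit.PneNP.PneNP.Theses.RootDecompAlternationDial.BoundedAltLiftD := by
  unfold Summit.PneNP.PneNP.Theses.RootDecompAlternationDial.BoundedAltLiftD
  intro k hc
  exact Literature.Computability.Complexity.sigmaDepth_subset_P_of_bounded hc k fun _ => le_rfl

end Summit.PneNP.PneNP.Theorems
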